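import Summits.ABC.IUTFork.Repair.RHHullCellSlice
import Summits.ABC.IUTFork.Repair.RHLabelWeightSchemes
import HarnessLib

/-!
# D-0122 AXIS B (REQUIREMENT-SIDE REDESIGN), knobs k2 · k3 · k5 TYPED: the threshold `T`, the true-slice cutoff `j₀(w)` and the
# supply/requirement ratio as explicit functions of (k2) the LABEL SET `{1,…,L}` decoupled from the torsion level `l` (print: `L = l⋇`,
# with/without the `𝔽_l^{⋊±}` identification), (k3) the LOG-SHELL / INDETERMINACY allowance `(δ′, r_in′, r_out′)` in the hull term,
# (k5) the TARGET exponent `Λ₀`; singly and in the pairs/triples (k2,k3) · (k2,k5) · (k3,k5) · (k2,k3,k5)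

abc-iut cell, rung LADDER-ABC:A2.RESCUE.H; HUMAN D-0122 (2026-08-27T05:58Z) «IUT round 3 axis B = REQUIREMENT-SIDE REDESIGN: sensitivity of
threshold T and true-slice cutoff j0 to upstream IUT I–III design knobs … singly and in 2–3 combinations, via the exact LP + mass table on the
genuine bed»; seat abc-iut-reqb-typ-2 (typer k2/k3/k5; reqb-typ-1 holds k1/k4), owner abc-iut-rh-lead g3/g4 (`plan/rescue/R-H/ROUND3/REQB-SPEC.md`),
referee abc-iut-reqb-ref-1, engines reqb-lp-1 and reqb-lp-2. PROOF-ONLY file (0 definitions, 0 `Prop` facts): integer/rational arithmetic about OUR typed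
exact cell and label sums — the COLUMN FORMULAS the engines tabulate and the «ratio ≥ 1» criteria as iff's, nothing about IUT itself.

CURRENCY (by name, nothing retyped). Cell `(w, j)`: `RH.DiffPricedHull.HullCellδ e m j δ r_in r_out` ⟺ DEMAND `(j²−1)·m ≤` PRICE
`j·δ + (j+1)·(r_in − r_out) + ρ_j` (`HullCellSlice.hullCellδ_iff_demand_le_price`; `e = e_w`, `m = m_q(w)`, `δ` = different exponent, `r_in/r_out` =
log-shell radii); licensed labels at a place = initial segment `{1,…,J_w}` (`HullCellSlice.exists_sliceBoundary`; `J_w = j₀(w)`); label mass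
`S(n) := Σ_{j≤n}(j²−1) = n(n−1)(2n+5)/6` (`CellWeights.sum_fin_sqSubOne`); per datum `μ = Σ_w ω_w S(J_w)/(S(l⋇)·Σ_w ω_w)` (`ω_w` = the place weight
`c_w·m_w ≥ 0` of MIN-SLICE §(i)), requirement of record `T = (1−μ)·M`, exponent `Λ = 1/μ` (EXP programme). Below `S(n)` is always written out as
`n(n−1)(2n+5)/6`.

TYPED FORMS (`L ≥ 2` wherever a ratio is formed, since `S(1) = 0`).
* §1 **k2 LABEL SET `{1,…,L}`, `L` free** (print: `L = l⋇ = (l−1)/2`). SATURATION `sliceBoundary_restrict`: `j₀(w)_mod = min(L, j₀(w))` (no new cell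
  evaluation); per place `supply(L) = S(min(J_w,L))`, `requirement(L) = S(L)`, `T_mod(L) ∝ S(L) − S(min(J_w,L))` nondecreasing in `L`
  (`unlicensedMass_mono`); `labelRatio_ge_one_iff`: ratio `≥ 1 ⟺ L ≤ J`; pooled with weights `ω_w > 0`, `pooledLabelRatio_ge_one_iff`: `≥ 1 ⟺
  L ≤ min_w j₀(w)`. «WITHOUT the `𝔽_l^{⋊±}` identification» = every label `±j` twice, same orders: `ratio_invariant_under_multiplicity` (`μ`, ratio, `j₀`
  unchanged); the adjoined zero label is a licensed weight-`(−m)` cell (`hullCellδ_zero`). PRINT-SHAPE companion (the constant, not the mass): `n` labels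
  uniformly averaged at torsion level `l` give the [IUTchIV] Thm 1.10-shape constant `C(n,l) = 2l·E_n[j+1]/(E_n[j²]−1) = 6l(n+3)/((2n+5)(n−1))` in front
  of the `(j+1)`-weighted error side (`decoupledConstant_eq`; `= 6l(l+5)/((l−3)(l+4))` = rh2-w-2 `uniformConstant_eq` at `n = l⋇`, `decoupledConstant_at_lstar`),
  DECREASING in `n` (`decoupledConstant_succ_le`), `> 3l/n` (`decoupledConstant_gt`): a fully licensed truncated label set `n = min_w j₀(w)` trades the
  CUBIC licence-cut loss `1/μ ≍ (l⋇/j₀)³` for a LINEAR constant loss `C(n,l)/C(l⋇,l) ≍ l⋇/n` — the (k2,k5) row.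
* §2 **k3 SHELL / INDETERMINACY ALLOWANCE** `(δ, r_in, r_out) ↦ (δ′, r_in′, r_out′)`: the cell is MONOTONE in the allowance (`hullCellδ_mono_rin`,
  `hullCellδ_anti_rout`, `hullCellδ_mono_shell`; `δ`: rp-d3's `hullCellδ_mono`), hence so is `j₀` (`sliceBoundary_mono_shell`).
  FULL SUPPLY on `{1,…,L}`: sufficient `(L²−1)m ≤ L·δ′ + (L+1)(r_in′ − r_out′)` (`fullLicence_of_linear`), necessary the same `+ (e−1)` (`linear_of_fullLicence`);
  the additive loosening a short place needs is bracketed by `loosening_needed_bracket` (multiplicatively `τ_crit ≈ (L²−1)m/(Lδ + (L+1)G)`, `G = r_in − r_out`;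
  on the genuine tower `≈ H_v/(4(1+L_v))`, the local Szpiro excess — a DATUM-LEVEL quantity, flagged for the rf seats / N12, not judged here). CONE-SIDE
  COUPLING (bookkeeping): loosening every tensor slot by `Δ` enlarges the label-`j` container by `(j+1)·Δ`, `= E_L[j+1]·Δ = Δ(L+3)/2` per label on average
  (`shellLoosening_containerCost`).
* §3 **k5 TARGET STRENGTH `Λ₀`** (abc with exponent `Λ₀`; EXP doors `abcExpOn_farFromCusps_of_licenceOn_mu_content_hregC` p485274 / `abcExp_of_licenceOn_mu_content_hregC`
  p486860 BY NAME; R19: the all-triples form carries `GenEll_thm21_primesWith Λ₀`): `requirement(Λ₀) = M/Λ₀`, `T_mod(Λ₀) = M/Λ₀ − supply`, ratio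
  `= Λ₀·supply/M`; `targetRatio_ge_one_iff` (`⟺ M/Λ₀ ≤ supply`), `targetRatio_ge_one_iff_inv_mu_le` (`⟺ Λ₀ ≥ M/supply = 1/μ`), `requirement_anti`,
  and the Q1′ form `offMass_le_muCut_iff`: `[MU-C](1/Λ₀)` «`B_triv(Σᶜ) ≤ (1 − 1/Λ₀)M + Tol`» ⟺ `supply ≥ M/Λ₀ − Tol`.
* §4 **PAIRS / TRIPLES**: (k2,k5) `labelTargetRatio_ge_one_iff` with the necessary size `Λ₀ ≥ (L/J)²·(2L+5)/(2J+5)` (`targetExp_lb_of_labelTargetRatio_ge_one`,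
  rh2-w-1 `sqSubOneSum_frac_le_cubic`); (k2,k3) `fullSupply_iff_forall_boundary_ge` (ratio `1` on `{1,…,L}` under modified shells ⟺ `L ≤ J_w′` ∀ `w`);
  (k3,k5)/(k2,k3,k5) `pooledTargetRatio_ge_one_of_forall` (every weighted place meeting `Λ₀·sup_w ≥ S(L)` ⟹ pooled ratio `≥ 1`).
* §5 WORKED ROWS (`decide`/`norm_num`) on the tree's three heavy places (`HullCellSlice.rows_worked_example` integers): HEX `λ₈@l=11`, `p = 7`
  `(e,m,δ,r_in,r_out) = (165,120,164,28,−281)`, `l⋇ = 5`, `J = 4`: k2 full at `L = 4`; k3 full at `L = 5` iff `δ′ ≥ 204` (radii fixed; `δ = 164`, `+24 %`);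
  Frey `2⁵67⁸…@l=13` (`l⋇ = 6`): `p = 3` wild `(390,660,779,196,−1707)`, `J = 4`, k3 full iff `δ′ ≥ 1587` (`×2.04`); `p = 53` `(65,30,64,2,−12)`, `J = 3`,
  k3 full iff `δ′ ≥ 157` (`×2.45`); k2 full datum-wide iff `L ≤ 3`; constants `C(4,11)/C(5,11) = 35/26`, `C(3,13)/C(6,13) = 85/33`.

CONSISTENCY (the rf seats' column; recorded only as the questions these parameters raise, no verdict): k2 — in [IUTchI–III] the label set is
`|𝔽_l| ∖ {0}` because the evaluation points are the `l`-torsion points permuted transitively by the `𝔽_l^{⋊±}`-symmetry (a proper subset `{1,…,L}` is not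
symmetry-stable); k3 — `δ`, `r_in`, `r_out` are invariants of `K_w`, and a looser hull allowance is charged term by term on the container side (§2
coupling); k5 — a weaker target is always consistent, its price is the statement proved.

HONEST FRAMING: arithmetic about OUR typed cell and label sums; the knob values are HYPOTHETICAL modifications, not readings of print; nothing here
asserts that abc is proved or refuted, that [IUTchIII] Cor. 3.12 / [IUTchIV] Thm. 1.10 holds or fails, or takes a side on any author; typed ≠ proved;
computed ≠ proved. [claim: Mochizuki2012, status: disputed] for every IUT locution. [cite: Mochizuki2012, IUTchIII Prop. 3.9 (i) p. 116, Rmk. 3.9.3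
p. 119–120, Cor. 3.12 p. 173–174; IUTchIV Prop. 1.2 p. 10, Prop. 1.4 p. 13, Thm. 1.10 Steps (v)–(viii) p. 27–30]
-/

noncomputable section

namespace Summit.ABC.IUTFork.Repair.RH.ReqsideLabelsInd

open Summit.ABC.IUTFork.Repair.RH.DiffPricedHull Summit.ABC.IUTFork.Repair.RH.HullCellSlice
  Summit.ABC.IUTFork.Repair.RH.CellWeights

/-! ## §1. k2 — the label set `{1,…,L}` with `L` decoupled from `l` -/

section LabelSet

/-- **k2 (a) SATURATION of the boundary.** If `J'` is the slice boundary of the cell column on the range `{1,…,L'}` and `1 ≤ L ≤ L'`, then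
`min(L, J')` is the boundary on `{1,…,L}`: `j₀(w)_mod(L) = min(L, j₀(w))` — the truncated label set needs no new cell evaluation. (Pure logic; no
structural hypothesis.) [folklore] -/
theorem sliceBoundary_restrict {e m δ rin rout L L' J' : ℤ} (hLL : L ≤ L')
    (hJ' : ∀ j : ℤ, 1 ≤ j → j ≤ L' → (HullCellδ e m j δ rin rout ↔ j ≤ J')) :
    ∀ j : ℤ, 1 ≤ j → j ≤ L → (HullCellδ e m j δ rin rout ↔ j ≤ min L J') := by
  intro j hj hjL
  rw [hJ' j hj (hjL.trans hLL), le_min_iff]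
  exact ⟨fun h => ⟨hjL, h⟩, fun h => h.2⟩

/-- `S` is strictly increasing on `n ≥ 1`: for reals `1 ≤ a < b`, `a(a−1)(2a+5)/6 < b(b−1)(2b+5)/6`
(`S(b) − S(a) = (b−a)(2a² + 2ab + 2b² + 3a + 3b − 5)/6`). [folklore] -/
theorem sqSubOneSum_strictMono {a b : ℝ} (ha : 1 ≤ a) (hab : a < b) :
    a * (a - 1) * (2 * a + 5) / 6 < b * (b - 1) * (2 * b + 5) / 6 := by
  have key : b * (b - 1) * (2 * b + 5) / 6 - a * (a - 1) * (2 * a + 5) / 6 =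
      (b - a) * (2 * a ^ 2 + 2 * a * b + 2 * b ^ 2 + 3 * a + 3 * b - 5) / 6 := by ring
  have h2 : 0 < 2 * a ^ 2 + 2 * a * b + 2 * b ^ 2 + 3 * a + 3 * b - 5 := by nlinarith
  nlinarith [mul_pos (sub_pos.mpr hab) h2]

/-- `S` is nondecreasing on `n ≥ 1` (reals `1 ≤ a ≤ b`). [folklore] -/
theorem sqSubOneSum_mono_real {a b : ℝ} (ha : 1 ≤ a) (hab : a ≤ b) :
    a * (a - 1) * (2 * a + 5) / 6 ≤ b * (b - 1) * (2 * b + 5) / 6 :=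
  hab.lt_or_eq.elim (fun h => (sqSubOneSum_strictMono ha h).le) fun h => h ▸ le_rfl

/-- `S(L) > 0` for `L ≥ 2` (the ratio's denominator). [folklore] -/
theorem sqSubOneSum_pos {L : ℝ} (hL : 2 ≤ L) : 0 < L * (L - 1) * (2 * L + 5) / 6 := by
  obtain ⟨h1, h2, h3⟩ : 0 < L ∧ 0 < L - 1 ∧ 0 < 2 * L + 5 := ⟨by linarith, by linarith, by linarith⟩
  positivity

/-- **k2 (b) THE SINGLE-PLACE CRITERION**: for a place with boundary `J ≥ 1` and a label set `{1,…,L}`, `L ≥ 2`, the supply/requirement ratio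
`S(min(J,L))/S(L)` is `≥ 1` iff `L ≤ J` (then it equals `1`). [folklore] -/
theorem labelRatio_ge_one_iff {J L : ℝ} (hJ : 1 ≤ J) (hL : 2 ≤ L) :
    1 ≤ (min J L * (min J L - 1) * (2 * min J L + 5) / 6) / (L * (L - 1) * (2 * L + 5) / 6) ↔ L ≤ J := by
  have hSL := sqSubOneSum_pos hL
  rw [le_div_iff₀ hSL, one_mul]
  constructor
  · intro h
    by_contra hlt
    push Not at hlt
    rw [min_eq_left hlt.le] at h
    exact absurd h (not_le.mpr (sqSubOneSum_strictMono hJ hlt))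
  · intro h
    rw [min_eq_right h]

/-- **k2 (b) `T_mod(L)` IS NONDECREASING IN `L`**: the unlicensed label mass of a place, `S(L) − S(min(J,L))`, can only grow with the top label
(`1 ≤ J`, `1 ≤ L ≤ L'`). So «`T` as a function of `l⋇`» is monotone: every extra label above `j₀(w)` is pure requirement. [folklore] -/
theorem unlicensedMass_mono {J L L' : ℝ} (hJ : 1 ≤ J) (hL : 1 ≤ L) (hLL : L ≤ L') :
    L * (L - 1) * (2 * L + 5) / 6 - min J L * (min J L - 1) * (2 * min J L + 5) / 6 ≤
      L' * (L' - 1) * (2 * L' + 5) / 6 - min J L' * (min J L' - 1) * (2 * min J L' + 5) / 6 := by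
  rcases le_total J L with hJL | hLJ
  · rw [min_eq_left hJL, min_eq_left (hJL.trans hLL)]
    linarith [sqSubOneSum_mono_real hL hLL]
  · rw [min_eq_right hLJ, sub_self]
    have h1 : 1 ≤ min J L' := le_min hJ (hL.trans hLL)
    linarith [sqSubOneSum_mono_real h1 (min_le_right J L')]

/-- **k2 (b) POOLED OVER PLACES.** Places `w ∈ s` (nonempty) with weights `ω_w > 0` and boundaries `J_w ≥ 1`; label set `{1,…,L}`, `L ≥ 2`. The pooled
supply/requirement ratio `(Σ_w ω_w S(min(J_w,L)))/(Σ_w ω_w S(L))` is `≥ 1` iff `L ≤ J_w` at EVERY place of `s` — i.e. iff `L ≤ min_w j₀(w)`; the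
`h_v`-weights never rescue a place whose slice is short. [folklore] -/
theorem pooledLabelRatio_ge_one_iff {ι : Type*} (s : Finset ι) (hs : s.Nonempty) (ω J : ι → ℝ) (hω : ∀ w ∈ s, 0 < ω w)
    (hJ : ∀ w ∈ s, 1 ≤ J w) {L : ℝ} (hL : 2 ≤ L) :
    1 ≤ (∑ w ∈ s, ω w * (min (J w) L * (min (J w) L - 1) * (2 * min (J w) L + 5) / 6)) /
        (∑ w ∈ s, ω w * (L * (L - 1) * (2 * L + 5) / 6)) ↔ ∀ w ∈ s, L ≤ J w := by
  have hSL := sqSubOneSum_pos hL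
  have hden : 0 < ∑ w ∈ s, ω w * (L * (L - 1) * (2 * L + 5) / 6) :=
    Finset.sum_pos (fun w hw => mul_pos (hω w hw) hSL) hs
  rw [le_div_iff₀ hden, one_mul]
  have hle : ∀ w ∈ s, ω w * (min (J w) L * (min (J w) L - 1) * (2 * min (J w) L + 5) / 6) ≤
      ω w * (L * (L - 1) * (2 * L + 5) / 6) := fun w hw =>
    mul_le_mul_of_nonneg_left (sqSubOneSum_mono_real (le_min (hJ w hw) (by linarith)) (min_le_right _ _)) (hω w hw).le
  constructor
  · intro h
    by_contra hne
    push Not at hne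
    obtain ⟨w₀, hw₀, hlt⟩ := hne
    have hstrict : ω w₀ * (min (J w₀) L * (min (J w₀) L - 1) * (2 * min (J w₀) L + 5) / 6) <
        ω w₀ * (L * (L - 1) * (2 * L + 5) / 6) := by
      rw [min_eq_left hlt.le]
      exact mul_lt_mul_of_pos_left (sqSubOneSum_strictMono (hJ w₀ hw₀) hlt) (hω w₀ hw₀)
    have := Finset.sum_lt_sum hle ⟨w₀, hw₀, hstrict⟩
    linarith
  · exact fun h => Finset.sum_le_sum fun w hw => by rw [min_eq_right (h w hw)]

/-- **k2 (c) «WITHOUT the `𝔽_l^{⋊±}` identification»**: listing every label `±j` twice (same orders, same cell) multiplies supply AND requirement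
by the same multiplicity `k ≠ 0` — the ratio, `μ`, and `j₀` are invariant; only the normalising count changes. [folklore] -/
theorem ratio_invariant_under_multiplicity {k A B : ℝ} (hk : k ≠ 0) : k * A / (k * B) = A / B :=
  mul_div_mul_left A B hk

/-- **k2 (c) the zero label is always licensed** (`0 < e`, `r_out ≤ r_in`, `0 ≤ m`): its demand is `(0²−1)·m = −m ≤ 0`; adjoining it (label set
`𝔽_l` instead of `|𝔽_l| ∖ {0}`) adds one licensed cell of NEGATIVE weight `−m` and changes nothing above. [folklore] -/
theorem hullCellδ_zero {e m δ rin rout : ℤ} (he : 0 < e) (hio : rout ≤ rin) (hm : 0 ≤ m) : HullCellδ e m 0 δ rin rout :=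
  hullCellδ_of_linear he (by norm_num; omega)

/-- **k2 (d) THE DECOUPLED PRINT-SHAPE CONSTANT.** With `n ≥ 2` labels uniformly averaged at torsion level `l` (any real `l`), the constant of the
[IUTchIV] Thm 1.10-shape inequality `((E_n[j²]−1)/2l)·log q ≤ E_n[j+1]·A + B` in front of `A` is
`C(n,l) := 2l·(Σ_{j≤n}(j+1))/(Σ_{j≤n}(j²−1)) = 6l(n+3)/((2n+5)(n−1))` (rh2-w-2 `uniformRatio_eq`). [folklore] -/
theorem decoupledConstant_eq {n : ℕ} (hn : 2 ≤ n) (l : ℝ) :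
    2 * l * ((∑ i : Fin n, ((((i : ℕ) : ℝ) + 1) + 1)) / (∑ i : Fin n, ((((i : ℕ) : ℝ) + 1) ^ 2 - 1))) =
      6 * l * ((n : ℝ) + 3) / ((2 * n + 5) * ((n : ℝ) - 1)) := by
  rw [uniformRatio_eq hn]
  have h2 : (2 : ℝ) ≤ n := by exact_mod_cast hn
  obtain ⟨h1, h5⟩ : (n : ℝ) - 1 ≠ 0 ∧ (2 : ℝ) * n + 5 ≠ 0 := ⟨by linarith, by linarith⟩
  field_simp
  ring

/-- **At `n = l⋇` the decoupled constant IS print's** (`l = 2n+1`): `C(l⋇, l) = 6l(l+5)/((l−3)(l+4))` (rh2-w-2 `uniformConstant_eq`). [folklore] -/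
theorem decoupledConstant_at_lstar {n : ℕ} (hn : 2 ≤ n) :
    6 * (2 * (n : ℝ) + 1) * ((n : ℝ) + 3) / ((2 * n + 5) * ((n : ℝ) - 1)) =
      6 * (2 * (n : ℝ) + 1) * ((2 * (n : ℝ) + 1) + 5) / (((2 * (n : ℝ) + 1) - 3) * ((2 * (n : ℝ) + 1) + 4)) := by
  have h2 : (2 : ℝ) ≤ n := by exact_mod_cast hn
  obtain ⟨h1, h5⟩ : (n : ℝ) - 1 ≠ 0 ∧ (2 : ℝ) * n + 5 ≠ 0 := ⟨by linarith, by linarith⟩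
  obtain ⟨h3, h4⟩ : (2 * (n : ℝ) + 1) - 3 ≠ 0 ∧ (2 * (n : ℝ) + 1) + 4 ≠ 0 := ⟨by linarith, by linarith⟩
  field_simp
  ring

/-- **Truncation COSTS: `C(n,l)` is decreasing in `n`** (`n ≥ 2`, `l ≥ 0`): `C(n+1,l) ≤ C(n,l)`, since
`(n+3)(2n+7)n − (n+4)(2n+5)(n−1) = 2n² + 14n + 20 > 0`. [folklore] -/
theorem decoupledConstant_succ_le {n : ℕ} (hn : 2 ≤ n) {l : ℝ} (hl : 0 ≤ l) :
    6 * l * (((n : ℝ) + 1) + 3) / ((2 * ((n : ℝ) + 1) + 5) * (((n : ℝ) + 1) - 1)) ≤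
      6 * l * ((n : ℝ) + 3) / ((2 * n + 5) * ((n : ℝ) - 1)) := by
  have h2 : (2 : ℝ) ≤ n := by exact_mod_cast hn
  have hd1 : 0 < (2 * ((n : ℝ) + 1) + 5) * (((n : ℝ) + 1) - 1) := by nlinarith
  have hd2 : 0 < (2 * (n : ℝ) + 5) * ((n : ℝ) - 1) := by nlinarith
  rw [div_le_div_iff₀ hd1 hd2]
  have key : ((n : ℝ) + 3) * ((2 * ((n : ℝ) + 1) + 5) * (((n : ℝ) + 1) - 1)) -
      (((n : ℝ) + 1) + 3) * ((2 * n + 5) * ((n : ℝ) - 1)) = 2 * (n : ℝ) ^ 2 + 14 * n + 20 := by ring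
  nlinarith [key]

/-- **`C(n,l) > 3l/n`** (`n ≥ 2`, `l > 0`): the exponent factor `C(n,l)/6` of an `n`-label theory exceeds `l/(2n)` — LINEAR in `l⋇/n`, against the
CUBIC licence-cut loss `1/μ ≍ (l⋇/j₀)³` of keeping all `l⋇` labels. (`2n(n+3) − (2n+5)(n−1) = 3n + 5 > 0`.) [folklore] -/
theorem decoupledConstant_gt {n : ℕ} (hn : 2 ≤ n) {l : ℝ} (hl : 0 < l) :
    3 * l / n < 6 * l * ((n : ℝ) + 3) / ((2 * n + 5) * ((n : ℝ) - 1)) := by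
  have h2 : (2 : ℝ) ≤ n := by exact_mod_cast hn
  have hn0 : (0 : ℝ) < n := by linarith
  have hd2 : 0 < (2 * (n : ℝ) + 5) * ((n : ℝ) - 1) := by nlinarith
  rw [div_lt_div_iff₀ hn0 hd2]
  nlinarith

end LabelSet

/-! ## §2. k3 — the log-shell / indeterminacy allowance `(δ, r_in, r_out) ↦ (δ′, r_in′, r_out′)` in the hull term -/

section Shell

/-- **A larger inner radius exponent only helps** (`0 < e`, `0 ≤ j+1`, `r_in ≤ r_in′`): the content shift decreases. [folklore] -/
theorem hullCellδ_mono_rin {e m j δ rin rin' rout : ℤ} (he : 0 < e) (hj : 0 ≤ j + 1) (h : rin ≤ rin')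
    (hc : HullCellδ e m j δ rin rout) : HullCellδ e m j δ rin' rout := by
  unfold HullCellδ at hc ⊢
  have hle : j ^ 2 * m - j * δ - (j + 1) * rin' ≤ j ^ 2 * m - j * δ - (j + 1) * rin := by
    nlinarith [mul_le_mul_of_nonneg_left h hj]
  have hdiv := Int.ediv_le_ediv he hle
  nlinarith [mul_le_mul_of_nonneg_left hdiv he.le]

/-- **A smaller outer radius exponent only helps** (`0 ≤ j+1`, `r_out′ ≤ r_out`): the q-side room `m − (j+1)·r_out` grows. [folklore] -/
theorem hullCellδ_anti_rout {e m j δ rin rout rout' : ℤ} (hj : 0 ≤ j + 1) (h : rout' ≤ rout)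
    (hc : HullCellδ e m j δ rin rout) : HullCellδ e m j δ rin rout' := by
  unfold HullCellδ at hc ⊢
  nlinarith [mul_le_mul_of_nonneg_left h hj]

/-- **k3 MONOTONICITY IN THE WHOLE ALLOWANCE**: `δ ≤ δ′`, `r_in ≤ r_in′`, `r_out′ ≤ r_out` (a LOOSER shell / larger indeterminacy) keep every
licensed cell licensed (`0 < e`, `0 ≤ j`). A TIGHTER allowance can only unlicense cells in this currency. [folklore] -/
theorem hullCellδ_mono_shell {e m j δ δ' rin rin' rout rout' : ℤ} (he : 0 < e) (hj : 0 ≤ j) (hδ : δ ≤ δ') (hi : rin ≤ rin')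
    (ho : rout' ≤ rout) (hc : HullCellδ e m j δ rin rout) : HullCellδ e m j δ' rin' rout' :=
  hullCellδ_anti_rout (by omega) ho (hullCellδ_mono_rin he (by omega) hi (hullCellδ_mono he hj hδ hc))

/-- **k3: `j₀` IS MONOTONE IN THE ALLOWANCE.** Old boundary `J` on `{1,…,L}` at `(δ, r_in, r_out)`, new boundary `J'` on the same range at a looser
`(δ′, r_in′, r_out′)`: then `J ≤ J'`. [folklore] -/
theorem sliceBoundary_mono_shell {e m δ δ' rin rin' rout rout' L J J' : ℤ} (he : 0 < e) (hδ : δ ≤ δ') (hi : rin ≤ rin')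
    (ho : rout' ≤ rout) (hJ1 : 1 ≤ J) (hJL : J ≤ L)
    (hJ : ∀ j : ℤ, 1 ≤ j → j ≤ L → (HullCellδ e m j δ rin rout ↔ j ≤ J))
    (hJ' : ∀ j : ℤ, 1 ≤ j → j ≤ L → (HullCellδ e m j δ' rin' rout' ↔ j ≤ J')) : J ≤ J' :=
  (hJ' J hJ1 hJL).1 (hullCellδ_mono_shell he (by omega) hδ hi ho ((hJ J hJ1 hJL).2 le_rfl))

/-- **k3 FULL SUPPLY, sufficient half**: at a local type (`0 < e`, `e − 1 ≤ δ′`, `r_out′ ≤ r_in′`, `0 ≤ m`), if the TOP label clears the floor-free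
price, `(L²−1)·m ≤ L·δ′ + (L+1)·(r_in′ − r_out′)`, then EVERY label `1 ≤ j ≤ L` is licensed: the place supplies its whole requirement
(`j₀(w)_mod = L`). [folklore] -/
theorem fullLicence_of_linear {e m δ' rin' rout' L : ℤ} (he : 0 < e) (hδ' : e - 1 ≤ δ') (hio' : rout' ≤ rin') (hm : 0 ≤ m)
    (h : (L ^ 2 - 1) * m ≤ L * δ' + (L + 1) * (rin' - rout')) :
    ∀ j : ℤ, 1 ≤ j → j ≤ L → HullCellδ e m j δ' rin' rout' :=
  fun _ hj hjL => hullCellδ_anti he hδ' hio' hm hj hjL (hullCellδ_of_linear he h)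

/-- **k3 FULL SUPPLY, necessary half** (`0 < e`): if the top label `L` is licensed then `(L²−1)·m ≤ L·δ′ + (L+1)·(r_in′ − r_out′) + (e − 1)`.
[folklore] -/
theorem linear_of_fullLicence {e m δ' rin' rout' L : ℤ} (he : 0 < e) (h : HullCellδ e m L δ' rin' rout') :
    (L ^ 2 - 1) * m ≤ L * δ' + (L + 1) * (rin' - rout') + (e - 1) :=
  linear_of_hullCellδ he h

/-- **k3 THE LOOSENING A SHORT PLACE NEEDS, bracketed** (`0 < e`): if the top label `L` is OFF at the old allowance and ON at the new one, then
`L·δ + (L+1)(r_in − r_out) ≤ (L²−1)m − 1` and `(L²−1)m − (e−1) ≤ L·δ′ + (L+1)(r_in′ − r_out′)` — so the additive loosening of the top-label price is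
`≥ (L²−1)m − (e−1) − (L·δ + (L+1)(r_in − r_out))`, while `≥ (L²−1)m − (L·δ + (L+1)(r_in − r_out))` already suffices (`fullLicence_of_linear`). [folklore] -/
theorem loosening_needed_bracket {e m δ δ' rin rin' rout rout' L : ℤ} (he : 0 < e)
    (hold : ¬ HullCellδ e m L δ rin rout) (hnew : HullCellδ e m L δ' rin' rout') :
    L * δ + (L + 1) * (rin - rout) ≤ (L ^ 2 - 1) * m - 1 ∧
      (L ^ 2 - 1) * m - (e - 1) ≤ L * δ' + (L + 1) * (rin' - rout') :=
  ⟨linear_lt_of_not_hullCellδ he hold, by have := linear_of_hullCellδ he hnew; linarith⟩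

/-- **k3 CONE-SIDE COUPLING (bookkeeping).** Loosening every tensor slot by `Δ` enlarges the label-`j` container by `(j+1)·Δ`; summed over the
label set `{1,…,L}` this is `Δ·L(L+3)/2`, i.e. `E_L[j+1]·Δ = Δ·(L+3)/2` per label on average (rh2-w-2 `sum_fin_labelSlots`) — the amount the
error side `A` of the Thm 1.10-shape display grows by. [folklore] -/
theorem shellLoosening_containerCost (Δ : ℝ) (L : ℕ) :
    ∑ i : Fin L, ((((i : ℕ) : ℝ) + 1) + 1) * Δ = Δ * ((L : ℝ) * (L + 3) / 2) := by
  rw [← Finset.sum_mul, sum_fin_labelSlots]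
  ring

end Shell

/-! ## §3. k5 — the target exponent `Λ₀` -/

section Target

/-- **k5 THE TARGET COLUMN**: with total mass `M > 0`, supply (licensed mass) `sup` and target exponent `Λ₀ > 0`, the ratio
`Λ₀·sup/M = sup/requirement(Λ₀)`, `requirement(Λ₀) = M/Λ₀`, is `≥ 1` iff `M/Λ₀ ≤ sup` (iff `T_mod(Λ₀) = M/Λ₀ − sup ≤ 0`). [folklore] -/
theorem targetRatio_ge_one_iff {M sup Λ₀ : ℝ} (hM : 0 < M) (hΛ : 0 < Λ₀) :
    1 ≤ Λ₀ * sup / M ↔ M / Λ₀ ≤ sup := by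
  rw [le_div_iff₀ hM, div_le_iff₀ hΛ, one_mul, mul_comm]

/-- **k5 in exponent form** (`sup > 0`): the same criterion reads `M/sup ≤ Λ₀`, i.e. `Λ₀ ≥ 1/μ`, `μ = sup/M` (EXP programme's «kept fraction `μ` ⟹
exponent `1/μ`» read as a requirement on the target). [folklore] -/
theorem targetRatio_ge_one_iff_inv_mu_le {M sup Λ₀ : ℝ} (hM : 0 < M) (hsup : 0 < sup) (hΛ : 0 < Λ₀) :
    1 ≤ Λ₀ * sup / M ↔ M / sup ≤ Λ₀ := by
  rw [targetRatio_ge_one_iff hM hΛ, div_le_iff₀ hΛ, div_le_iff₀ hsup, mul_comm]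

/-- **k5 a weaker target needs less**: `requirement(Λ₀) = M/Λ₀` is antitone in `Λ₀` (`M ≥ 0`, `0 < Λ₀ ≤ Λ₀′`). At `Λ₀ = 1` it is `M` and
`T_mod(1) = M − sup = (1−μ)M = T` of record. [folklore] -/
theorem requirement_anti {M Λ₀ Λ₀' : ℝ} (hM : 0 ≤ M) (hΛ : 0 < Λ₀) (hle : Λ₀ ≤ Λ₀') : M / Λ₀' ≤ M / Λ₀ :=
  div_le_div_of_nonneg_left hM hΛ hle

/-- **k5 joint with Q1′ (MIN-SLICE)**: the weighted hypothesis `[MU-C](μ₀)` at `μ₀ = 1/Λ₀`, «off-slice trivial mass `B_triv(Σᶜ) = M − sup ≤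
(1 − 1/Λ₀)·M + Tol`», is the same inequality as «`sup ≥ M/Λ₀ − Tol`»: the minimum slice for exponent `Λ₀` is any slice of mass
`≥ M/Λ₀ − Tol`. [folklore] -/
theorem offMass_le_muCut_iff (M sup Tol Λ₀ : ℝ) :
    M - sup ≤ (1 - 1 / Λ₀) * M + Tol ↔ M / Λ₀ - Tol ≤ sup := by
  have : (1 - 1 / Λ₀) * M = M - M / Λ₀ := by ring
  rw [this]
  constructor <;> intro h <;> linarith

end Target

/-! ## §4. Pairs and triples -/

section Combinations

/-- **(k2,k5)**: label set `{1,…,L}` (`L ≥ 2`), boundary `J`, target `Λ₀`: the ratio `Λ₀·S(min(J,L))/S(L)` is `≥ 1` iff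
`S(L) ≤ Λ₀·S(min(J,L))` (the engines' (k2,k5) cell test). [folklore] -/
theorem labelTargetRatio_ge_one_iff {J L : ℝ} (Λ₀ : ℝ) (hL : 2 ≤ L) :
    1 ≤ Λ₀ * (min J L * (min J L - 1) * (2 * min J L + 5) / 6) / (L * (L - 1) * (2 * L + 5) / 6) ↔
      L * (L - 1) * (2 * L + 5) / 6 ≤ Λ₀ * (min J L * (min J L - 1) * (2 * min J L + 5) / 6) := by
  rw [le_div_iff₀ (sqSubOneSum_pos hL), one_mul]

/-- **(k2,k5) HOW WEAK THE TARGET MUST BE (cubic law)**: naturals `2 ≤ J ≤ L`; if `Λ₀·S(J) ≥ S(L)` then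
`Λ₀·(2J+5)·J² ≥ (2L+5)·L²`, i.e. `Λ₀ ≥ (L/J)²·(2L+5)/(2J+5) ≍ (l⋇/j₀)³` (rh2-w-1 `sqSubOneSum_frac_le_cubic`). [folklore] -/
theorem targetExp_lb_of_labelTargetRatio_ge_one {J L : ℕ} {Λ₀ : ℝ} (hJ : 2 ≤ J) (hJL : J ≤ L)
    (h : (L : ℝ) * (L - 1) * (2 * L + 5) / 6 ≤ Λ₀ * ((J : ℝ) * (J - 1) * (2 * J + 5) / 6)) :
    (2 * (L : ℝ) + 5) * (L : ℝ) ^ 2 ≤ Λ₀ * ((2 * (J : ℝ) + 5) * (J : ℝ) ^ 2) := by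
  have hcub := sqSubOneSum_frac_le_cubic hJL
  have hJ2 : (2 : ℝ) ≤ J := by exact_mod_cast hJ
  have hSJ : 0 < (J : ℝ) * (J - 1) * (2 * J + 5) / 6 := sqSubOneSum_pos hJ2
  have hB : 0 ≤ (2 * (J : ℝ) + 5) * (J : ℝ) ^ 2 := by positivity
  have h1 := mul_le_mul_of_nonneg_right h hB
  have h3 : (J : ℝ) * (J - 1) * (2 * J + 5) / 6 * ((2 * (L : ℝ) + 5) * (L : ℝ) ^ 2) ≤
      (J : ℝ) * (J - 1) * (2 * J + 5) / 6 * (Λ₀ * ((2 * (J : ℝ) + 5) * (J : ℝ) ^ 2)) := by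
    nlinarith [hcub.trans h1]
  exact le_of_mul_le_mul_left h3 hSJ

/-- **(k2,k3) FULL SUPPLY ON A TRUNCATED LABEL SET UNDER MODIFIED SHELLS**: places `w ∈ s`, each with a boundary `J′_w` of its (modified) column
on `{1,…,L}`; then «every cell `(w, j)`, `1 ≤ j ≤ L`, is licensed» ⟺ «`L ≤ J′_w` for every `w ∈ s`» (ratio `= 1` exactly; test each place with
`fullLicence_of_linear` / `linear_of_fullLicence`). [folklore] -/
theorem fullSupply_iff_forall_boundary_ge {ι : Type*} (s : Finset ι) (cell : ι → ℤ → Prop) (J' : ι → ℤ) {L : ℤ} (hL : 1 ≤ L)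
    (hJ' : ∀ w ∈ s, ∀ j : ℤ, 1 ≤ j → j ≤ L → (cell w j ↔ j ≤ J' w)) :
    (∀ w ∈ s, ∀ j : ℤ, 1 ≤ j → j ≤ L → cell w j) ↔ ∀ w ∈ s, L ≤ J' w :=
  ⟨fun h w hw => (hJ' w hw L hL le_rfl).1 (h w hw L hL le_rfl),
    fun h w hw j hj hjL => (hJ' w hw j hj hjL).2 (hjL.trans (h w hw))⟩

/-- **(k3,k5) / (k2,k3,k5) POOLED FROM PLACEWISE**: places `w ∈ s` (nonempty), weights `ω_w > 0`, per-place supplies `sup_w` and a common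
per-place requirement `req > 0` (`= S(L)`), target `Λ₀`: if every place meets `req ≤ Λ₀·sup_w` then the pooled ratio
`Λ₀·(Σ ω_w sup_w)/(Σ ω_w req)` is `≥ 1`. (The converse fails: pooling CAN rescue a short place once `Λ₀ > 1`, unlike §1's `Λ₀ = 1` case.)
[folklore] -/
theorem pooledTargetRatio_ge_one_of_forall {ι : Type*} (s : Finset ι) (hs : s.Nonempty) (ω sup : ι → ℝ) {req Λ₀ : ℝ}
    (hω : ∀ w ∈ s, 0 < ω w) (hreq : 0 < req) (h : ∀ w ∈ s, req ≤ Λ₀ * sup w) :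
    1 ≤ Λ₀ * (∑ w ∈ s, ω w * sup w) / (∑ w ∈ s, ω w * req) := by
  have hden : 0 < ∑ w ∈ s, ω w * req := Finset.sum_pos (fun w hw => mul_pos (hω w hw) hreq) hs
  rw [le_div_iff₀ hden, one_mul, Finset.mul_sum]
  exact Finset.sum_le_sum fun w hw => by nlinarith [h w hw, hω w hw]

end Combinations

/-! ## §5. Worked rows on the tree's three heavy places (integers of `HullCellSlice.rows_worked_example`) -/

section Rows

/-- **HEX `λ₈ @ l = 11`, `p = 7`** `(e,m,δ,r_in,r_out) = (165,120,164,28,−281)`, `l⋇ = 5`, `j₀ = 4`. k2: the label set `{1,…,4}` is fully licensed.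
k3 (radii fixed): the top label `5` is licensed iff `δ′ ≥ 204` (`δ = 164`: `+40`, factor `≈ 1.24` on the different term; `+7.5 %` on the
top-label price `5δ + 6G = 2674`). [folklore] -/
theorem row_hex8_l11 :
    (HullCellδ 165 120 1 164 28 (-281) ∧ HullCellδ 165 120 2 164 28 (-281) ∧ HullCellδ 165 120 3 164 28 (-281) ∧
        HullCellδ 165 120 4 164 28 (-281) ∧ ¬ HullCellδ 165 120 5 164 28 (-281)) ∧
      (HullCellδ 165 120 5 204 28 (-281) ∧ ¬ HullCellδ 165 120 5 203 28 (-281)) := by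
  unfold HullCellδ
  decide

/-- **Frey `2⁵67⁸107·22381 + 5⁴53⁶353⁵ @ l = 13`** (`l⋇ = 6`): `p = 3` wild `(390,660,779,196,−1707)`, `j₀ = 4`, top label licensed iff `δ′ ≥ 1587`
(`δ = 779`, factor `2.04`); `p = 53` `(65,30,64,2,−12)`, `j₀ = 3`, top label licensed iff `δ′ ≥ 157` (`δ = 64`, factor `2.45`). k2 on this datum:
full supply iff `L ≤ min(4,3) = 3`. [folklore] -/
theorem row_frey13 :
    (HullCellδ 390 660 6 1587 196 (-1707) ∧ ¬ HullCellδ 390 660 6 1586 196 (-1707)) ∧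
      (HullCellδ 65 30 6 157 2 (-12) ∧ ¬ HullCellδ 65 30 6 156 2 (-12)) ∧
        (HullCellδ 65 30 3 64 2 (-12) ∧ ¬ HullCellδ 65 30 4 64 2 (-12)) := by
  unfold HullCellδ
  decide

/-- **The (k2,k5) constants at these rows**: `C(4,11)/C(5,11) = (7/(13·3))/(8/(15·4)) = 35/26` (HEX `λ₈@11`, truncating `l⋇ = 5 → 4` costs the factor
`35/26 ≈ 1.35` on print's constant, against the licence-cut exponent `S(5)/S(4) = 50/26 ≈ 1.92`); `C(3,13)/C(6,13) = (6/(11·2))/(9/(17·5)) =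
85/33 ≈ 2.58` (Frey@13, `l⋇ = 6 → 3`); and `S(5) = 50`, `S(4) = 26`, `S(6) = 85`, `S(3) = 11`. [folklore] -/
theorem row_constants :
    ((4 : ℝ) + 3) / ((2 * 4 + 5) * (4 - 1)) / ((5 + 3) / ((2 * 5 + 5) * (5 - 1))) = 35 / 26 ∧
      ((3 : ℝ) + 3) / ((2 * 3 + 5) * (3 - 1)) / ((6 + 3) / ((2 * 6 + 5) * (6 - 1))) = 85 / 33 ∧
        ((5 : ℝ) * (5 - 1) * (2 * 5 + 5) / 6 = 50 ∧ (4 : ℝ) * (4 - 1) * (2 * 4 + 5) / 6 = 26 ∧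
          (6 : ℝ) * (6 - 1) * (2 * 6 + 5) / 6 = 85 ∧ (3 : ℝ) * (3 - 1) * (2 * 3 + 5) / 6 = 11) := by
  norm_num

end Rows

end Summit.ABC.IUTFork.Repair.RH.ReqsideLabelsInd

end
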